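import Summits.HodgeConjecture.HodgeConjecture.Theorems.CyclicUnitaryPowersCubeHilbert
import Summits.HodgeConjecture.HodgeConjecture.Theorems.CyclicUnitaryPowersCyclicCoverIrreducible
import Literature.AlgebraicGeometry.HodgeTheory.ComplexConjugationHolds

/-!
# K1 deck-model Hodge numbers from Carlson–Toledo 1999: the seam
# `stub_cyclicDeckHodge ⟸ carlsonToledo1999_finrank_eigenspace_deck_one ∧ …_inf_hodgePiece`
# (route `CyclicUnitaryPowers`, item stmt-HodgeConjecture-19544)

Helper file for the K1 line `unitary-reflection-zariski` (v4, skeleton `3de443e76f2487c2`, cell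
`hodge-nonav`, seat P3 g19) of crux `VeryGeneralDeckCommutatorsInHg` (rank 2) of route
`route-HodgeConjecture-CyclicUnitaryPowers`; landed `--supports stmt-HodgeConjecture-19544` (helper: it
closes nothing and does not land the stub unconditionally — the statement below is CONDITIONAL on two
named facts). Prover seat `hodge-nonav-prover-A` (g0), 2026-08-27. Sorry-free, no definition, no new fact.

## What is proved

`cyclicDeckHodge_of_carlsonToledo`: the registered stub `stub_cyclicDeckHodge` — VERBATIM as the
conclusion (sig `HOME/p3/k1lineA-v4-g19/sig_S_DECKH.txt`: for prime `p ≥ 7`, `f ≠ 0` homogeneous of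
degree `p` with smooth projective model `X_F`, `F = x₃^p − f`, and `σ = diagonalAut F ha` the canonical
deck map, (iii) `dim_ℚ H²(X_F;ℚ)^{σ^*} = 1` and (iv) `dim_ℂ (E_{ζ^j}(σ^*_ℂ) ∩ H^{2−q,q}) = ehn p j q`
for some primitive `p`-th root `ζ`) — FOLLOWS from the two named Literature facts of
`HodgeTheory/CyclicCoverEigenHodgeNumbers` (littype-FH1-2, p517792):
`carlsonToledo1999_finrank_eigenspace_deck_one` (Carlson–Toledo 1999 §2: the invariant line) and
`carlsonToledo1999_finrank_eigenspace_inf_hodgePiece` (§5 with Griffiths 1969 / Voisin II Cor. 6.12: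
the `ζ_p^i`-eigenspace meets `H^{2−q,q}` in dimension `dim R_f^{(q+1)p−3−i}`). So the line's lead may
RETIRE `stub_cyclicDeckHodge` into these two cited theorems (as v4 retired the envelope into
`nonempty_carlsonToledoFamily`): K1-A then reads "B2 (`stub_unitaryReflectionDensity`) modulo five
published facts".

Proof: (iii) is the first fact on the nose (`cyclicCoverForm`, `deckUnit` unfold to the route's
spelling); for (iv) take `ζ = e^{2πi/p}` (`Complex.isPrimitiveRoot_exp`), read `dim R_f^{(q+1)p−3−j}` off
the second fact, and evaluate it: the model is smooth, so `J_f` contains a power of every variable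
(`CyclicUnitaryPowersCyclicCoverIrreducible.exists_X_pow_mem_jacobianIdeal_of_isSmoothProjective`, the
Jacobian direction), hence Macaulay's Hilbert function applies and equals the route's `cube p`
(`CyclicUnitaryPowersCubeHilbert`): `hilbert_jacobianIdeal_eq_cube_getD`.

## References

* [CarlsonToledo1999] J. A. Carlson, D. Toledo, Discriminant complements and kernels of monodromy
  representations, Duke Math. J. 97 (1999); arXiv alg-geom/9708002, §2 (held text p0005), §5
  (p0011–p0012).
* [VoisinHodgeII2003] C. Voisin, Hodge Theory and Complex Algebraic Geometry II, CUP 2003, §6.1.3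
  Thm. 6.10, Cor. 6.12 (held text chunks p0159, p0161).
* [Kloosterman2023] R. Kloosterman, Variational Hodge conjecture for complete intersections on
  hypersurfaces in projective space, Rend. Sem. Mat. Univ. Padova 148 (2023), §2 eq. (1).
-/

noncomputable section

namespace Summit.HodgeConjecture.HodgeConjecture.Theorems.CyclicUnitaryPowersDeckHodgeOfCarlsonToledo

open scoped TensorProduct
open Literature.AlgebraicGeometry.Motives Literature.AlgebraicGeometry.HodgeTheory
open Literature.AlgebraicGeometry.HodgeTheory.BettiUniverse
open Literature.AlgebraicTopology.SingularHomology
open Literature.RingTheory.MvPolynomial (idealDegree)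
open Summit.HodgeConjecture.HodgeConjecture.Theorems.CyclicUnitaryPowersCubeHilbert
  (foldl_pmul_replicate_getD_eq_ciHilbert hilbert_jacobianIdeal_ternary_eq_ciHilbert)
open Summit.HodgeConjecture.HodgeConjecture.Theorems.CyclicUnitaryPowersCyclicCoverIrreducible
  (exists_X_pow_mem_jacobianIdeal_of_isSmoothProjective)
open CategoryTheory MvPolynomial

variable {p : ℕ} {f : MvPolynomial (Fin 3) ℂ}

/-! ### §1 `dim R_f^a = (cube p)_a` for smooth models -/

/-- **The eigen-Hodge numbers in closed form**: for a smooth model, Carlson–Toledo's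
`dim R_f^{a}` is the route's list coefficient `cube p` at `a` (`= ciHilbert [p−1,p−1,p−1] a`).
[cite: CarlsonToledo1999, §5 (held text p0011–p0012)] [cite: Kloosterman2023, §2 eq. (1)] -/
theorem hilbert_jacobianIdeal_eq_cube_getD (hp : 2 ≤ p) (hf : f.IsHomogeneous p) (hf0 : f ≠ 0)
    (hXF : IsSmoothProjective 2 (SmoothHypersurface.hypersurface (cyclicCoverForm p f))) (a : ℕ) :
    Module.finrank ℂ ↥(MvPolynomial.homogeneousSubmodule (Fin 3) ℂ a) -
        Module.finrank ℂ ↥(idealDegree (UniversalHypersurface.jacobianIdeal f) a) =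
      ((List.replicate 3 (List.replicate (p - 1) 1)).foldl
        (fun a b : List ℕ => (List.range (a.length + b.length - 1)).map fun k =>
          ((List.range (k + 1)).map fun i => a.getD i 0 * b.getD (k - i) 0).sum) [1]).getD a 0 := by
  obtain ⟨M, -, hXM⟩ := exists_X_pow_mem_jacobianIdeal_of_isSmoothProjective hp hf hf0 hXF
  rw [hilbert_jacobianIdeal_ternary_eq_ciHilbert hf hp hXM a, foldl_pmul_replicate_getD_eq_ciHilbert]


/-! ### §2 The seam: `stub_cyclicDeckHodge` from the two Carlson–Toledo facts -/

/- The registered `let`-prefix binds `pmul`; after `intro` it is only used through `ehn`. -/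
set_option linter.unusedVariables false in
/-- **`stub_cyclicDeckHodge` (K1 line `unitary-reflection-zariski` v4, crux
`VeryGeneralDeckCommutatorsInHg`, registered signature VERBATIM as the conclusion) follows from the two
named facts `carlsonToledo1999_finrank_eigenspace_deck_one` (clause (iii), Carlson–Toledo 1999 §2) and
`carlsonToledo1999_finrank_eigenspace_inf_hodgePiece` (clause (iv), §5 with Griffiths / Voisin II
Cor. 6.12).** Clause (iii) is the first fact on the nose (`cyclicCoverForm`, `deckUnit` unfold to the
route's spelling); for (iv) take `ζ = e^{2πi/p}` (`Complex.isPrimitiveRoot_exp`), read the dimension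
`dim R_f^{(q+1)p−3−j}` off the second fact, and evaluate it by §5 (`hXF ⇒` Artinian Jacobian ring) and
§§1–2 (Macaulay's Hilbert function `= ciHilbert [p−1,p−1,p−1] =` the route's `ehn p j q`).
[cite: CarlsonToledo1999, §2 (held text p0005) and §5 (held text p0011–p0012)]
[cite: VoisinHodgeII2003, §6.1.3 Thm. 6.10 and Cor. 6.12 (held text chunks p0159, p0161)] -/
theorem cyclicDeckHodge_of_carlsonToledo
    (h₁ : carlsonToledo1999_finrank_eigenspace_deck_one)
    (h₂ : carlsonToledo1999_finrank_eigenspace_inf_hodgePiece) :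
    open Literature.AlgebraicGeometry.Motives Literature.AlgebraicGeometry.HodgeTheory Literature.AlgebraicGeometry.HodgeTheory.BettiUniverse CategoryTheory.Limits in let pmul : List ℕ → List ℕ → List ℕ := fun a b => (List.range (a.length + b.length - 1)).map fun k => ((List.range (k + 1)).map fun i => a.getD i 0 * b.getD (k - i) 0).sum; let ehn : ℕ → ℕ → ℕ → ℕ := fun p j q => if (q + 1) * p < 3 + j then 0 else ((List.replicate 3 (List.replicate (p - 1) 1)).foldl pmul [1]).getD ((q + 1) * p - 3 - j) 0; ∀ ⦃p : ℕ⦄, p.Prime → 7 ≤ p → ∀ f : MvPolynomial (Fin 3) ℂ, f.IsHomogeneous p → f ≠ 0 → ∀ (hXF : IsSmoothProjective 2 (SmoothHypersurface.hypersurface (MvPolynomial.X (Fin.last 3) ^ p - MvPolynomial.rename Fin.castSucc f))) (ha : (fun i : Fin 4 => if i = Fin.last 3 then (Units.mk0 (Complex.exp (2 * (Real.pi : ℂ) * Complex.I / (p : ℂ))) (Complex.exp_ne_zero _)) else 1) ∈ diagonalStabilizer (MvPolynomial.X (Fin.last 3) ^ p - MvPolynomial.rename Fin.castSucc f)), Module.finrank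 ℚ ↥(Module.End.eigenspace (pull (diagonalAut (MvPolynomial.X (Fin.last 3) ^ p - MvPolynomial.rename Fin.castSucc f) ha) 2) 1) = 1 ∧ ∃ ζ : ℂ, IsPrimitiveRoot ζ p ∧ ∀ j q : ℕ, 1 ≤ j → j < p → q ≤ 2 → Module.finrank ℂ ↥(Module.End.eigenspace ((pull (diagonalAut (MvPolynomial.X (Fin.last 3) ^ p - MvPolynomial.rename Fin.castSucc f) ha) 2).baseChange ℂ) (ζ ^ j) ⊓ (hodge exists_isReal_hodgeModel_holds hXF 2).piece ((2 : ℤ) - q) q) = ehn p j q := by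
  intro pmul ehn p hp h7 f hf hf0 hXF ha
  have hp3 : 3 ≤ p := by omega
  refine ⟨h₁ hp3 f hf hf0 hXF ha, Complex.exp (2 * (Real.pi : ℂ) * Complex.I / (p : ℂ)),
    Complex.isPrimitiveRoot_exp p (by omega), fun j q hj hjp hq ↦ ?_⟩
  refine (h₂ exists_isReal_hodgeModel_holds hp3 f hf hf0 hXF ha j q hj hjp hq).trans ?_
  simp only [ehn, pmul]
  split_ifs with hlt
  · rfl
  · exact hilbert_jacobianIdeal_eq_cube_getD (by omega) hf hf0 hXF _



end Summit.HodgeConjecture.HodgeConjecture.Theorems.CyclicUnitaryPowersDeckHodgeOfCarlsonToledo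

end
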